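import Mathlib
import Literature.Computability.AlgebraicComplexity.LR21Datum
import Literature.Computability.AlgebraicComplexity.StandardFamilies
import Summits.ValiantsHypothesis.ValiantsHypothesis.Theorems.RigidityForcesSymmetryPairTiedTorusBoundDefs
import Summits.ValiantsHypothesis.ValiantsHypothesis.Theorems.RigidityForcesSymmetryRankRigidMinimalReprWeightTyping
import Summits.ValiantsHypothesis.ValiantsHypothesis.Theorems.RigidityForcesSymmetryRankRigidMinimalReprPathExpansion

/-!
# Crux `RankRigidMinimalRepr` (stmt-ValiantsHypothesis-18034), line `PairTiedTorusBound`, stub `stub_levelDecomp` —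
# step 4: the LEVEL NODES of a weight-graded path expansion give typed level decompositions

Route `ValiantsHypothesis/RigidityForcesSymmetry`, registered line `Cruxes/RankRigidMinimalRepr/Lines/PairTiedTorusBound.lean`,
dictionary stub `stub_levelDecomp` (helper 4).  Here `m + 1` = size of the permanent, `n` = number of internal nodes
(the matrix has size `n + 1`).

**Statement (`levelDecomp_of_graded_path_expansion`).**  Let `b, c` be vectors and `D` an `n × n` matrix of linear
forms in the `x_{ij}` with `-bᵀ D^{(m+1)-2} c = κ · perm_{m+1}` (`κ ≠ 0`) — the path expansion of
`…RankRigidMinimalReprPathExpansion.lean` — which are WEIGHT-GRADED for the generic element of the tied torus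
`tiedTorus (m+1) k` (variable `x_{ij}` of weight `p_i · q_{tc j}`, `tc j = 0` for tied `j ≤ k`, `tc j = j` otherwise;
node weights `θ u`, source weight `γ₀ ≠ 0`, sink weight `(∏ p ∏ q_{tc}) · γ₀`): every monomial of `b_s` carries
`θ s` to the sink weight, of `c_r` carries `γ₀` to `θ r`, of `D_{rs}` carries `θ s` to `θ r`.  Then for every level
`1 ≤ s ≤ m`, `perm_{m+1} = Σ_u P_u Q_u` with `P_u = -κ⁻¹ (bᵀ D^{s-1})_u`, `Q_u = (D^{m-s} c)_u`, the GOOD nodes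
(`P_u ≠ 0 ≠ Q_u`) give a `TiedLevelDecomposable (m+1) k s (w s)` (typing by `WeightTyping.typed_of_weights`), and a
node is good at ONE level only (`level_eq_of_weights`), so `Σ_s w s ≤ n`.

HONEST FRAMING: helper toward ONE registered stub of a forward rung inside one route; nothing here bears on the
crux `RankRigidMinimalRepr` itself or on `VP ≠ VNP`.
-/

set_option autoImplicit false

-- the mandated summit-side namespace repeats a component by design (single-problem summit)
set_option linter.dupNamespace false

noncomputable section

open MvPolynomial Finset Matrix
open Literature.Computability.AlgebraicComplexity LRPencil
open Summit.ValiantsHypothesis.ValiantsHypothesis.Theorems.RigidityForcesSymmetryPairTiedTorusBound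

namespace Summit.ValiantsHypothesis.ValiantsHypothesis.Theorems.RigidityForcesSymmetryRankRigidMinimalRepr

namespace LevelNodes

open WeightTyping

variable {m : ℕ} (k : ℕ)

/-- **One node lives at one level.**  With the pairing hypothesis of `WeightTyping.typed_of_weights` against one
non-zero `Q`, two non-zero `P₁, P₂` whose monomials have degrees `s₁`, `s₂` have `s₁ = s₂` (the row set is read off
`Q`, which both complements type). -/
theorem level_eq_of_weights {P₁ P₂ Q : MvPolynomial (Fin (m + 1) × Fin (m + 1)) ℂ}
    (h₁ : ∀ δ ∈ P₁.support, ∀ δ' ∈ Q.support,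
      (∏ v : Fin (m + 1) × Fin (m + 1),
          (primes₂ (m + 1) (Sum.inl v.1) * primes₂ (m + 1) (Sum.inr (if v.2.val ≤ k then 0 else v.2))) ^ δ v) *
        (∏ v : Fin (m + 1) × Fin (m + 1),
          (primes₂ (m + 1) (Sum.inl v.1) * primes₂ (m + 1) (Sum.inr (if v.2.val ≤ k then 0 else v.2))) ^ δ' v) =
      (∏ i : Fin (m + 1), primes₂ (m + 1) (Sum.inl i)) *
        ∏ j : Fin (m + 1), primes₂ (m + 1) (Sum.inr (if j.val ≤ k then 0 else j)))
    (h₂ : ∀ δ ∈ P₂.support, ∀ δ' ∈ Q.support,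
      (∏ v : Fin (m + 1) × Fin (m + 1),
          (primes₂ (m + 1) (Sum.inl v.1) * primes₂ (m + 1) (Sum.inr (if v.2.val ≤ k then 0 else v.2))) ^ δ v) *
        (∏ v : Fin (m + 1) × Fin (m + 1),
          (primes₂ (m + 1) (Sum.inl v.1) * primes₂ (m + 1) (Sum.inr (if v.2.val ≤ k then 0 else v.2))) ^ δ' v) =
      (∏ i : Fin (m + 1), primes₂ (m + 1) (Sum.inl i)) *
        ∏ j : Fin (m + 1), primes₂ (m + 1) (Sum.inr (if j.val ≤ k then 0 else j)))
    (hP₁ : P₁ ≠ 0) (hP₂ : P₂ ≠ 0) (hQ : Q ≠ 0) {s₁ s₂ : ℕ}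
    (hdeg₁ : ∀ δ ∈ P₁.support, (∑ v, δ v) = s₁) (hdeg₂ : ∀ δ ∈ P₂.support, (∑ v, δ v) = s₂) : s₁ = s₂ := by
  classical
  obtain ⟨I₁, c₁, c₁', ct₁, ct₁', hI₁, -, hQ₁t, -, -⟩ := typed_of_weights k h₁ hP₁ hQ hdeg₁
  obtain ⟨I₂, c₂, c₂', ct₂, ct₂', hI₂, -, hQ₂t, -, -⟩ := typed_of_weights k h₂ hP₂ hQ hdeg₂
  obtain ⟨δ', hδ'⟩ : ∃ δ', δ' ∈ Q.support := by
    obtain ⟨d, hd⟩ := MvPolynomial.ne_zero_iff.1 hQ; exact ⟨d, MvPolynomial.mem_support_iff.2 hd⟩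
  have e1 := (hQ₁t δ' hδ').1
  have e2 := (hQ₂t δ' hδ').1
  have hI : I₁ = I₂ := by
    ext i
    have h1 := e1 i
    have h2 := e2 i
    rw [h1] at h2
    by_cases hi1 : i ∈ I₁ <;> by_cases hi2 : i ∈ I₂ <;>
      simp [mem_compl, hi1, hi2] at h2 <;> tauto
  rw [← hI₁, ← hI₂, hI]

/-- **Level nodes of a weight-graded path expansion.**  See the module docstring: from `-bᵀ D^{(m+1)-2} c = κ perm_{m+1}`
with `b, D` linear and `b, c, D` weight-graded for the generic tied-torus element, typed level decompositions of
`perm_{m+1}` with `w s` products at each level `1 ≤ s ≤ m` and `Σ_s w s + 1 ≤ n + 1`. -/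
theorem levelDecomp_of_graded_path_expansion {n : ℕ}
    (b c : Fin n → MvPolynomial (Fin (m + 1) × Fin (m + 1)) ℂ)
    (D : Matrix (Fin n) (Fin n) (MvPolynomial (Fin (m + 1) × Fin (m + 1)) ℂ))
    (hb : ∀ j, (b j).IsHomogeneous 1) (hD : ∀ i j, (D i j).IsHomogeneous 1)
    (κ : ℂ) (hκ : κ ≠ 0) (hpath : -(b ⬝ᵥ (D ^ (m + 1 - 2)) *ᵥ c) = C κ * perPoly (Fin (m + 1)) ℂ)
    (θ : Fin n → ℂ) (γ₀ : ℂ) (hγ₀ : γ₀ ≠ 0)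
    (hbw : ∀ s, ∀ δ ∈ (b s).support,
      (∏ v : Fin (m + 1) × Fin (m + 1), ((primes₂ (m + 1) (Sum.inl v.1) : ℂ) *
          (primes₂ (m + 1) (Sum.inr (if v.2.val ≤ k then 0 else v.2)) : ℂ)) ^ δ v) * θ s =
        ((∏ i : Fin (m + 1), (primes₂ (m + 1) (Sum.inl i) : ℂ)) *
          ∏ j : Fin (m + 1), (primes₂ (m + 1) (Sum.inr (if j.val ≤ k then 0 else j)) : ℂ)) * γ₀)
    (hcw : ∀ r, ∀ δ ∈ (c r).support,
      (∏ v : Fin (m + 1) × Fin (m + 1), ((primes₂ (m + 1) (Sum.inl v.1) : ℂ) *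
          (primes₂ (m + 1) (Sum.inr (if v.2.val ≤ k then 0 else v.2)) : ℂ)) ^ δ v) * γ₀ = θ r)
    (hDw : ∀ r s, ∀ δ ∈ (D r s).support,
      (∏ v : Fin (m + 1) × Fin (m + 1), ((primes₂ (m + 1) (Sum.inl v.1) : ℂ) *
          (primes₂ (m + 1) (Sum.inr (if v.2.val ≤ k then 0 else v.2)) : ℂ)) ^ δ v) * θ s = θ r) :
    ∃ w : ℕ → ℕ, (∑ s ∈ Finset.range m, w (s + 1)) + 1 ≤ n + 1 ∧
      ∀ s : ℕ, 1 ≤ s → s + 1 ≤ m + 1 → TiedLevelDecomposable (m + 1) k s (w s) := by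
  classical
  -- the complex weight of a variable, the natural weight of a monomial and the character
  set wv : Fin (m + 1) × Fin (m + 1) → ℂ := fun v => ((primes₂ (m + 1) (Sum.inl v.1) : ℂ) *
    (primes₂ (m + 1) (Sum.inr (if v.2.val ≤ k then 0 else v.2)) : ℂ)) with hwv
  set WN : ((Fin (m + 1) × Fin (m + 1)) →₀ ℕ) → ℕ := fun δ =>
    ∏ v : Fin (m + 1) × Fin (m + 1),
      (primes₂ (m + 1) (Sum.inl v.1) * primes₂ (m + 1) (Sum.inr (if v.2.val ≤ k then 0 else v.2))) ^ δ v with hWN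
  set ΩN : ℕ := (∏ i : Fin (m + 1), primes₂ (m + 1) (Sum.inl i)) *
    ∏ j : Fin (m + 1), primes₂ (m + 1) (Sum.inr (if j.val ≤ k then 0 else j)) with hΩN
  have hW : ∀ δ, (∏ v, wv v ^ δ v) = (WN δ : ℂ) := fun δ => by
    simp only [hwv, hWN]; push_cast; rfl
  have hΩ : ((∏ i : Fin (m + 1), (primes₂ (m + 1) (Sum.inl i) : ℂ)) *
      ∏ j : Fin (m + 1), (primes₂ (m + 1) (Sum.inr (if j.val ≤ k then 0 else j)) : ℂ)) = (ΩN : ℂ) := by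
    simp only [hΩN]; push_cast; rfl
  -- the level polynomials
  set Ps : ℕ → Fin n → MvPolynomial (Fin (m + 1) × Fin (m + 1)) ℂ :=
    fun s u => C (-κ⁻¹) * (b ᵥ* D ^ (s - 1)) u with hPs
  set Qs : ℕ → Fin n → MvPolynomial (Fin (m + 1) × Fin (m + 1)) ℂ :=
    fun s u => (D ^ (m - s) *ᵥ c) u with hQs
  -- (a) the identity at each level
  have hsum : ∀ s, 1 ≤ s → s ≤ m → perPoly (Fin (m + 1)) ℂ = ∑ u, Ps s u * Qs s u := by
    intro s hs1 hsm
    have e1 : m + 1 - 2 = (s - 1) + (m - s) := by omega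
    have h1 : b ⬝ᵥ (D ^ (m + 1 - 2)) *ᵥ c = ∑ u, (b ᵥ* D ^ (s - 1)) u * (D ^ (m - s) *ᵥ c) u := by
      rw [e1, pow_add, ← Matrix.mulVec_mulVec, Matrix.dotProduct_mulVec]; rfl
    have h2 : perPoly (Fin (m + 1)) ℂ = C κ⁻¹ * (C κ * perPoly (Fin (m + 1)) ℂ) := by
      rw [← mul_assoc, ← C_mul, inv_mul_cancel₀ hκ, C_1, one_mul]
    rw [h2, ← hpath, h1, mul_neg, Finset.mul_sum, ← Finset.sum_neg_distrib]
    refine Finset.sum_congr rfl fun u _ => ?_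
    rw [hPs, hQs, map_neg]
    ring
  -- (b) weights of the level polynomials
  have hDpow : ∀ (i : ℕ) (r s : Fin n), ∀ δ ∈ ((D ^ i) r s).support, (∏ v, wv v ^ δ v) * θ s = θ r :=
    carries_pow_apply wv hDw
  have hPw : ∀ s u, ∀ δ ∈ (Ps s u).support, (WN δ : ℂ) * θ u = (ΩN : ℂ) * γ₀ := by
    intro s u δ hδ
    rw [← hW, ← hΩ]
    exact carries_C_mul wv (-κ⁻¹) (carries_vecMul wv hbw (hDpow (s - 1)) u) δ hδ
  have hQw : ∀ s u, ∀ δ ∈ (Qs s u).support, (WN δ : ℂ) * γ₀ = θ u := by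
    intro s u δ hδ
    rw [← hW]
    exact carries_mulVec wv hcw (hDpow (m - s)) u δ hδ
  have hpair : ∀ s s' u, ∀ δ ∈ (Ps s u).support, ∀ δ' ∈ (Qs s' u).support, WN δ * WN δ' = ΩN := by
    intro s s' u δ hδ δ' hδ'
    have h1 := hPw s u δ hδ
    have h2 := hQw s' u δ' hδ'
    rw [← h2, ← mul_assoc] at h1
    have h3 : ((WN δ * WN δ' : ℕ) : ℂ) = (ΩN : ℂ) := by
      have := mul_right_cancel₀ hγ₀ h1
      exact_mod_cast this
    exact_mod_cast h3
  -- (c) degrees: `Ps s u` is a form of degree `s`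
  have hPdeg : ∀ s, 1 ≤ s → ∀ u, ∀ δ ∈ (Ps s u).support, (∑ v, δ v) = s := by
    intro s hs1 u δ hδ
    have hhom : (Ps s u).IsHomogeneous s := by
      rw [hPs]
      refine IsHomogeneous.C_mul ?_ _
      rw [Matrix.vecMul, dotProduct]
      refine IsHomogeneous.sum _ _ _ fun t _ => ?_
      have := (hb t).mul (PathExpansion.isHomogeneous_pow_apply hD (s - 1) t u)
      rwa [show 1 + (s - 1) = s by omega] at this
    have hd : δ.degree = s := by
      by_contra hne
      exact (MvPolynomial.mem_support_iff.1 hδ) (hhom.coeff_eq_zero hne)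
    rw [← Finsupp.degree_eq_sum]; exact hd
  -- (d) the good nodes of each level
  set Good : ℕ → Finset (Fin n) := fun s => univ.filter (fun u => Ps s u ≠ 0 ∧ Qs s u ≠ 0) with hGood
  refine ⟨fun s => (Good s).card, ?_, ?_⟩
  · -- the count: a node is good at one level only
    have hdisj : ∀ s ∈ Finset.range m, ∀ s' ∈ Finset.range m, s ≠ s' →
        Disjoint (Good (s + 1)) (Good (s' + 1)) := by
      intro s _ s' _ hss'
      rw [Finset.disjoint_left]
      intro u hu hu'
      rw [hGood, mem_filter] at hu hu'
      apply hss'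
      have := level_eq_of_weights k (hpair (s + 1) (s + 1) u) (hpair (s' + 1) (s + 1) u) hu.2.1 hu'.2.1 hu.2.2
        (hPdeg (s + 1) (by omega) u) (hPdeg (s' + 1) (by omega) u)
      omega
    have hcard : (∑ s ∈ Finset.range m, (Good (s + 1)).card) =
        ((Finset.range m).biUnion fun s => Good (s + 1)).card :=
      (Finset.card_biUnion hdisj).symm
    have hle : ((Finset.range m).biUnion fun s => Good (s + 1)).card ≤ n := by
      have := Finset.card_le_univ ((Finset.range m).biUnion fun s => Good (s + 1))
      rwa [Fintype.card_fin] at this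
    show (∑ s ∈ Finset.range m, (Good (s + 1)).card) + 1 ≤ n + 1
    omega
  · -- the decomposition at level `s`
    intro s hs1 hsm
    have hsm' : s ≤ m := by omega
    have typed : ∀ u ∈ Good s, ∃ (I : Finset (Fin (m + 1))) (cc cc' : Fin (m + 1) → ℕ) (ct ct' : ℕ),
        I.card = s ∧ IsTiedTyped (m + 1) k I cc ct (Ps s u) ∧ IsTiedTyped (m + 1) k Iᶜ cc' ct' (Qs s u) ∧
        (∀ j : Fin (m + 1), k < j.val → cc j + cc' j = 1) ∧
        ct + ct' = (univ.filter fun j : Fin (m + 1) => j.val ≤ k).card := by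
      intro u hu
      rw [hGood, mem_filter] at hu
      exact typed_of_weights k (hpair s s u) hu.2.1 hu.2.2 (hPdeg s hs1 u)
    choose! I cc cc' ct ct' hI hPt hQt hcc hct using typed
    set e := (Good s).equivFin with he
    refine ⟨fun t => I (e.symm t), fun t => cc (e.symm t), fun t => cc' (e.symm t), fun t => ct (e.symm t),
      fun t => ct' (e.symm t), fun t => Ps s (e.symm t), fun t => Qs s (e.symm t),
      fun t => hI _ (e.symm t).2, fun t => hPt _ (e.symm t).2, fun t => hQt _ (e.symm t).2,
      fun t => hcc _ (e.symm t).2, fun t => hct _ (e.symm t).2, ?_⟩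
    -- `perm = Σ_{good u} P_u Q_u`
    rw [hsum s hs1 hsm']
    have h1 : ∑ u, Ps s u * Qs s u = ∑ u ∈ Good s, Ps s u * Qs s u := by
      rw [hGood, Finset.sum_filter_of_ne]
      intro u _ hne
      constructor
      · intro h0; exact hne (by rw [h0, zero_mul])
      · intro h0; exact hne (by rw [h0, mul_zero])
    rw [h1, ← Finset.sum_coe_sort (Good s)]
    exact (Equiv.sum_comp e.symm (fun x : ↥(Good s) => Ps s x * Qs s x)).symm

end LevelNodes

end Summit.ValiantsHypothesis.ValiantsHypothesis.Theorems.RigidityForcesSymmetryRankRigidMinimalRepr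

end
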